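import Literature.NumberTheory.ComplexMultiplication.SiegelCMPointsCMAlgebraLocus
import Literature.NumberTheory.ComplexMultiplication.CMAlgebraTorusCentralizer
import Literature.Geometry.Kaehler.ComplexTorusEndomorphismAlgebraSemisimple
import HarnessLib

/-!
# CM points of `𝔥_n` for CM-algebras and the endomorphism algebra: a Rosati-STABLE commutative semisimple
# `T ⊆ End_ℚ(X_Z)` of dimension `2n` makes `Z` a CM point; `End_ℚ(X_Z)` commutative of dimension `2n` suffices;
# at a CM point `End_ℚ(X_Z) = ᵗh(Y)` iff `End_ℚ(X_Z)` is commutative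
# (Deligne 1982 I Ex. 3.7, Prop. 5.1; Shimura 1998 §5.1 Prop. 6, §24.10; Lange 2023 Prop. 7.2.6, Cor. 2.4.26)

Family `hodge`, lane `lit-hodgefound` (Track 2 foundations, Layer A3), seat `skel-3`, row **A3-G136** (FILE 6), sequel of
FILES 1–5 (`SiegelCMPointsCMAlgebra*`).  It turns the CM-type-locus datum of `SiegelCMPointsCountable.lean`
(`T ≤ endAlgRat (prinPeriod Z)`, reduced, commutative, `dim_ℚ T = 2n`) into a Shimura CM point as soon as `T` is STABLE
under the Rosati involution `A ↦ A† = rosati (−J) A` of `E_Z` — by the tree's `exists_isCMAlgTorusRat_of_comm_isReduced`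
(`T ≅ K₁ × ⋯ × K_t` acting with full degree) and FILE 4's Deligne-I-5.1 converse — and records the case where no choice is
involved: `End_ℚ(X_Z)` itself commutative of dimension `2n` (products of pairwise non-isogenous simple CM factors).
Topic `Literature/NumberTheory/ComplexMultiplication`, namespace `Literature.NumberTheory.ComplexMultiplication.SiegelCMAlgPoint`.
THEOREMS ONLY, all proved; no definition, no named fact, no instance, no notation (D-0026, net debt 0).

## Sources, verbatim

* P. Deligne, *Hodge cycles on abelian varieties* (LNM 900, 1982), I Example 3.7 (p. 42): «`E = End A` … a product of
  CM-fields over which `H_1(A, ℚ)` has dimension `1`»; I Prop. 5.1 (p. 53): «the Rosati involution on `E = End A` defined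
  by any polarization of `A` is complex conjugation».
* G. Shimura, *Abelian Varieties with Complex Multiplication and Modular Functions* (1998), §5.1 Prop. 6 (p. 39):
  «`End_Q(A) = ι(F)`» (simple case); §24.10 (pp. 161–162): CM points of CM-algebras, «`ᵗΦ(α)` … defines an element of
  `End_Q(A_w)`».
* H. Lange, *Abelian Varieties over the Complex Numbers* (2023), §7.2.3 Prop. 7.2.6 ((ii): «`End_ℚ(X)` contains a
  commutative semisimple `ℚ`-algebra of dimension `2g`»), §2.4.4 Cor. 2.4.26 (structure of `End_ℚ(X)`), §2.4.1
  Lemma 2.4.1 / Thm. 2.4.9 (`End_ℚ(X)` is Rosati-stable; positivity).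

## What is proved (`X_Z = prinPeriod Z`, `End_ℚ(X_Z) = endAlgRat (prinPeriod Z)`, `A† = rosati (−J_n) A`)

* §1 FROM A SUBALGEBRA TO A CM-ALGEBRA ACTION is the tree's `exists_isCMAlgTorusRat_of_comm_isReduced` (p19; a
  commutative reduced `T ≤ End_ℚ(X_Z)` with `dim_ℚ T = 2n` is the image `ρ(Y)` of a ring-injection of a product of
  number fields `Y = Π i, K i` with `(X_Z, ρ)` of full degree) — used by name.
* §2 ★ **`isCMPoint_of_subalgebra_of_forall_rosati_mem`** (such a `T` STABLE under `†` makes `Z` a CM point — the `Kᵢ` are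
  then CM fields by Deligne I 5.1), ★ **`isCMPoint_iff_exists_subalgebra_rosati_stable`** (CM points = the points of the
  CM-type locus admitting a `†`-STABLE witness `T`).
* §3 ★ **`isCMPoint_of_endAlgRat_comm`** (`End_ℚ(X_Z)` commutative of dimension `2n` ⇒ `Z` is a CM point: `End_ℚ(X_Z)` is
  semisimple (Poincaré) and `†`-stable (Lemma 2.4.1)), `IsCMPointOf.range_transposeRepPi_eq_endAlgRat_iff_comm` (at a CM
  point, `End_ℚ(X_Z) = ᵗh(Y)` iff `End_ℚ(X_Z)` is commutative — Deligne I 3.7), `IsCMPoint.finrank_endAlgRat_eq_of_comm`,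
  ★ **`isCMPoint_iff_finrank_endAlgRat_eq_of_comm`** (for `X_Z` with commutative `End_ℚ`: CM point ⟺ `dim_ℚ End_ℚ(X_Z) = 2n`).

* §4 WITH THE HODGE GROUP: `IsCMPoint.hodgeGroupC_comm` (Prop. 7.2.6 (ii) ⇒ (i) on complex points),
  `isCMPoint_of_exists_subalgebra_of_endAlgRat_comm` (on the CM-type locus, commutativity of `End_ℚ(X_Z)` suffices),
  ★★ **`isCMPoint_iff_hodgeGroupC_comm_of_endAlgRat_comm`** («special ⟺ CM» for `X_Z` with commutative `End_ℚ(X_Z)`: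
  `Z` is a CM point iff `Hg(X_Z)(ℂ)` is commutative).

SEQUEL (row A3-G137, gen 53): that EVERY point of the CM-type locus admits a `†`-stable witness — so that the CM-type
locus of `𝔥_n` is exactly the set of CM points — is `SiegelCMAlgPoint.isCMPoint_iff_exists_subalgebra` /
`setOf_isCMPoint_eq` / `isCMPoint_iff_hodgeGroupC_comm` of `SiegelCMPointsCMTypeLocus.lean` (Milne, *Complex
Multiplication*, Ch. I Prop. 3.6 (c), Exercise 3.10 (b), via `Geometry/Kaehler/ComplexTorusRosatiStableCMAlgebra.lean`);
the hypothesis «`End_ℚ(X_Z)` commutative» of §3–§4 below is thereby removed THERE (this file is imported by it and keeps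
the special cases BY NAME).

## References

* [Deligne1982HodgeCycles] P. Deligne, op. cit., I Example 3.7 (p. 42), I Prop. 5.1 (p. 53).
* [Shimura1998] G. Shimura, op. cit., §5.1 Prop. 6 (p. 39); §24.10, pp. 161–162.
* [Lange2023AbelianVarietiesComplex] H. Lange, op. cit., §2.4.1 Lemma 2.4.1, §2.4.4 Cor. 2.4.26 (p. 124), §7.2.3 Prop. 7.2.6.

## Provenance

Lane `lit-hodgefound`, seat `literature-prover-lit-hodgefound-skel-3-g52-0` (row A3-G136, FILE 6).
-/

noncomputable section

open scoped Classical Matrix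
open Matrix Module NumberField

namespace Literature.NumberTheory.ComplexMultiplication

namespace SiegelCMAlgPoint

open Literature.NumberTheory.Automorphic (siegelUpperHalfSpace)
open Literature.NumberTheory.ModularForms.SiegelUpperHalfSpace
open Literature.AlgebraicGeometry.ModuliOfAbelianVarieties
open Literature.AlgebraicGeometry.ModuliOfAbelianVarieties.SiegelModuli
open Literature.Geometry.Kaehler Literature.Geometry.Kaehler.ComplexTorus
open SiegelCMPoint

variable {g : ℕ}

/-! ## §1. A commutative reduced `T ≤ End_ℚ(X_Z)` of dimension `2n` is a full-degree action of a product of number fields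

This is the tree's `exists_isCMAlgTorusRat_of_comm_isReduced` (p19, `CMAlgebraTorusCommutativeSubalgebra.lean`: such a
`T` is the image `ρ(Y) = T` of a ring-injection of a product of number fields `Y ≅ T` with `(X_Z, ρ)` of full degree);
it is used BY NAME below, not restated. -/

/-! ## §2. A Rosati-STABLE witness of the CM-type locus makes a CM point -/

/-- ★ **A ROSATI-STABLE COMMUTATIVE SEMISIMPLE `T ⊆ End_ℚ(X_Z)` OF DIMENSION `2n` MAKES `Z` A CM POINT** with respect to
`Sp(n, ℚ)`: `T ≅ K₁ × ⋯ × K_t` acts with full degree (§1), the `Kᵢ` are CM fields and `†` is complex conjugation on `T`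
(Deligne I 5.1, FILE 4), and `Z` is the common fixed point of `ᵗρ(Y^u)` (Shimura §24.10).
[cite: Deligne1982HodgeCycles, I Prop. 5.1, p. 53] [cite: Shimura1998, §24.10, pp. 161–162] [cite: Lange2023AbelianVarietiesComplex, §7.2.3 Prop. 7.2.6 ((ii))] -/
theorem isCMPoint_of_subalgebra_of_forall_rosati_mem {Z : siegelUpperHalfSpace g}
    (T : Subalgebra ℚ (Matrix (Fin g ⊕ Fin g) (Fin g ⊕ Fin g) ℚ)) (hT : T ≤ endAlgRat (prinPeriod Z))
    (hred : IsReduced T) (hcomm : ∀ a ∈ T, ∀ b ∈ T, a * b = b * a)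
    (hdim : finrank ℚ T = Fintype.card (Fin g ⊕ Fin g)) (hst : ∀ a ∈ T, rosati (-Matrix.J (Fin g) ℚ) a ∈ T) :
    IsCMPoint Z := by
  haveI := hred
  obtain ⟨t, _, K, _, _, ρ, hρ, hrange⟩ := exists_isCMAlgTorusRat_of_comm_isReduced (prinPeriod Z) T hT hcomm hdim
  refine isCMPoint_of_isCMAlgTorusRat_of_forall_rosati_mem hρ fun a ↦ ?_
  have ha : ρ a ∈ T := hrange ▸ AlgHom.mem_range_self ρ a
  have ha' : rosati (-Matrix.J (Fin g) ℚ) (ρ a) ∈ ρ.range := by rw [hrange]; exact hst _ ha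
  obtain ⟨b, hb⟩ := (AlgHom.mem_range ρ).1 ha'
  exact ⟨b, hb.symm⟩

/-- ★ **CHARACTERISATION THROUGH THE CM-TYPE LOCUS: `Z` is a CM point iff `End_ℚ(X_Z)` contains a commutative semisimple
subalgebra `T` of dimension `2n` which is STABLE under the Rosati involution of `E_Z`** (⇒: `T = ᵗh(Y)`, on which `†` is
complex conjugation). [cite: Lange2023AbelianVarietiesComplex, §7.2.3 Prop. 7.2.6 ((ii))] [cite: Deligne1982HodgeCycles, I Prop. 5.1, p. 53] [cite: Shimura1998, §24.10, p. 162] -/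
theorem isCMPoint_iff_exists_subalgebra_rosati_stable (Z : siegelUpperHalfSpace g) :
    IsCMPoint Z ↔
      ∃ T : Subalgebra ℚ (Matrix (Fin g ⊕ Fin g) (Fin g ⊕ Fin g) ℚ), T ≤ endAlgRat (prinPeriod Z) ∧ IsReduced T ∧
        (∀ a ∈ T, ∀ b ∈ T, a * b = b * a) ∧ finrank ℚ T = Fintype.card (Fin g ⊕ Fin g) ∧
        ∀ a ∈ T, rosati (-Matrix.J (Fin g) ℚ) a ∈ T := by
  constructor
  · rintro ⟨t, _, K, _, _, _, h, hY, hZ⟩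
    refine ⟨(transposeRepPi h).range, ?_, isReduced_range_transposeRepPi hZ.1.injective, range_transposeRepPi_comm,
      finrank_range_transposeRepPi hZ.1.injective hY, ?_⟩
    · rintro _ ⟨a, rfl⟩
      exact (hZ.isCMAlgTorusRat hY).mem_endAlgRat a
    · rintro _ ⟨a, rfl⟩
      exact ⟨piComplexConj K a, hZ.transposeRepPi_piComplexConj a⟩
  · rintro ⟨T, hT, hred, hcomm, hdim, hst⟩
    exact isCMPoint_of_subalgebra_of_forall_rosati_mem T hT hred hcomm hdim hst

/-! ## §3. Commutative `End_ℚ(X_Z)`: no choice of `T` -/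

/-- ★ **`End_ℚ(X_Z)` COMMUTATIVE OF DIMENSION `2n` ⇒ `Z` IS A CM POINT**: `End_ℚ(X_Z)` is semisimple (Poincaré's complete
reducibility for the principally polarised `X_Z`), hence reduced, and stable under `†` (Lemma 2.4.1), so §2 applies with
`T = End_ℚ(X_Z)` — the case `X_Z ∼ A₁ × ⋯ × A_t` with pairwise non-isogenous simple CM factors, «`E = End A` … a product
of CM-fields over which `H_1(A, ℚ)` has dimension `1`». [cite: Deligne1982HodgeCycles, I Example 3.7, p. 42; I Prop. 5.1, p. 53]
[cite: Lange2023AbelianVarietiesComplex, §2.4.1 Lemma 2.4.1 and §2.4.4 Cor. 2.4.26] [cite: Shimura1998, §24.10, p. 162] -/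
theorem isCMPoint_of_endAlgRat_comm {Z : siegelUpperHalfSpace g}
    (hcomm : ∀ a ∈ endAlgRat (prinPeriod Z), ∀ b ∈ endAlgRat (prinPeriod Z), a * b = b * a)
    (hdim : finrank ℚ (endAlgRat (prinPeriod Z)) = Fintype.card (Fin g ⊕ Fin g)) : IsCMPoint Z := by
  haveI := (isRiemannForm_prinForm Z).isSemisimpleRing_endAlgRat
  letI : CommRing (endAlgRat (prinPeriod Z)) :=
    { (inferInstance : Ring (endAlgRat (prinPeriod Z))) with
      mul_comm := fun a b ↦ Subtype.ext (hcomm a a.2 b b.2) }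
  haveI : IsReduced (endAlgRat (prinPeriod Z)) := inferInstance
  exact isCMPoint_of_subalgebra_of_forall_rosati_mem (endAlgRat (prinPeriod Z)) le_rfl this hcomm hdim
    fun a ha ↦ rosati_mem_endAlgRat (prinPeriod Z) (isRiemannForm_prinForm Z).1 (isRiemannForm_prinForm Z).2.2
      (neg_J_map_ratCast_eq_latticeGram_prinForm Z) ha

section AtACMPoint

variable {t : Type} {K : t → Type} [∀ i, Field (K i)] [∀ i, NumberField (K i)] [∀ i, IsCMField (K i)] [Fintype t]
variable {h : (Π i, K i) →ₐ[ℚ] Matrix (Fin g ⊕ Fin g) (Fin g ⊕ Fin g) ℚ}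

/-- **At a CM point, `End_ℚ(X_Z) = ᵗh(Y)` iff `End_ℚ(X_Z)` is commutative** (`ᵗh(Y)` is its own centralizer — the tree's
`IsCMAlgTorusRat.range_eq_endAlgRat_iff_comm`). [cite: Deligne1982HodgeCycles, I Example 3.7, p. 42] [cite: Shimura1998, §5.1 Prop. 6, p. 39] -/
theorem IsCMPointOf.range_transposeRepPi_eq_endAlgRat_iff_comm (hY : finrank ℚ (Π i, K i) = 2 * g)
    {Z : siegelUpperHalfSpace g} (hZ : IsCMPointOf h Z) :
    (transposeRepPi h).range = endAlgRat (prinPeriod Z) ↔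
      ∀ a ∈ endAlgRat (prinPeriod Z), ∀ b ∈ endAlgRat (prinPeriod Z), a * b = b * a :=
  (hZ.isCMAlgTorusRat hY).range_eq_endAlgRat_iff_comm

/-- At a CM point with commutative `End_ℚ(X_Z)`: `dim_ℚ End_ℚ(X_Z) = 2n`. [cite: Deligne1982HodgeCycles, I Example 3.7, p. 42] -/
theorem IsCMPointOf.finrank_endAlgRat_eq_of_comm (hY : finrank ℚ (Π i, K i) = 2 * g) {Z : siegelUpperHalfSpace g}
    (hZ : IsCMPointOf h Z)
    (hcomm : ∀ a ∈ endAlgRat (prinPeriod Z), ∀ b ∈ endAlgRat (prinPeriod Z), a * b = b * a) :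
    finrank ℚ (endAlgRat (prinPeriod Z)) = Fintype.card (Fin g ⊕ Fin g) := by
  rw [← (hZ.range_transposeRepPi_eq_endAlgRat_iff_comm hY).2 hcomm]
  exact finrank_range_transposeRepPi hZ.1.injective hY

end AtACMPoint

/-- At a CM point with commutative `End_ℚ(X_Z)`, `dim_ℚ End_ℚ(X_Z) = 2n`. [cite: Deligne1982HodgeCycles, I Example 3.7, p. 42] -/
theorem IsCMPoint.finrank_endAlgRat_eq_of_comm {Z : siegelUpperHalfSpace g} (hZ : IsCMPoint Z)
    (hcomm : ∀ a ∈ endAlgRat (prinPeriod Z), ∀ b ∈ endAlgRat (prinPeriod Z), a * b = b * a) :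
    finrank ℚ (endAlgRat (prinPeriod Z)) = Fintype.card (Fin g ⊕ Fin g) := by
  obtain ⟨t, _, K, _, _, _, h, hY, hZ⟩ := hZ
  exact hZ.finrank_endAlgRat_eq_of_comm hY hcomm

/-- ★ **For `X_Z` with COMMUTATIVE `End_ℚ(X_Z)`: `Z` is a CM point iff `dim_ℚ End_ℚ(X_Z) = 2n`** («`E = End A` is a
product of CM-fields over which `H_1(A, ℚ)` has dimension `1`»). [cite: Deligne1982HodgeCycles, I Example 3.7, p. 42; I Prop. 5.1, p. 53]
[cite: Lange2023AbelianVarietiesComplex, §7.2.3 Prop. 7.2.6] -/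
theorem isCMPoint_iff_finrank_endAlgRat_eq_of_comm {Z : siegelUpperHalfSpace g}
    (hcomm : ∀ a ∈ endAlgRat (prinPeriod Z), ∀ b ∈ endAlgRat (prinPeriod Z), a * b = b * a) :
    IsCMPoint Z ↔ finrank ℚ (endAlgRat (prinPeriod Z)) = Fintype.card (Fin g ⊕ Fin g) :=
  ⟨fun hZ ↦ hZ.finrank_endAlgRat_eq_of_comm hcomm, isCMPoint_of_endAlgRat_comm hcomm⟩

/-! ## §4. With the Hodge group: on `X_Z` with commutative `End_ℚ`, «special point ⟺ CM point» -/

/-- **At a CM point `Hg(X_Z)(ℂ)` is commutative** (Prop. 7.2.6 (ii) ⇒ (i) AS PRINTED, on complex points; FILE 5 gave the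
real points). [cite: Lange2023AbelianVarietiesComplex, §7.2.3 Prop. 7.2.6 ((ii) ⇒ (i))] [cite: Shimura1998, §24.10, p. 162] -/
theorem IsCMPoint.hodgeGroupC_comm {Z : siegelUpperHalfSpace g} (hZ : IsCMPoint Z)
    {M N : Matrix.SpecialLinearGroup (Fin g ⊕ Fin g) ℂ} (hM : M ∈ hodgeGroupC (prinPeriod Z))
    (hN : N ∈ hodgeGroupC (prinPeriod Z)) : M * N = N * M :=
  (hZ.isAbelianVariety.hodgeGroupC_comm_iff_exists_comm_isReduced_le_endAlgRat.2 hZ.exists_comm_isReduced_le_endAlgRat)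
    M hM N hN

/-- **On the CM-type locus, COMMUTATIVITY of `End_ℚ(X_Z)` suffices** (no dimension count): a commutative reduced
`T ≤ End_ℚ(X_Z)` of dimension `2n` is maximal commutative («the centralizer of `T` is `T` itself»), so a commutative
`End_ℚ(X_Z)` equals `T` and §3 applies. [cite: Lange2023AbelianVarietiesComplex, §7.2.3 Prop. 7.2.6 (proof)] [cite: Deligne1982HodgeCycles, I Example 3.7, p. 42] -/
theorem isCMPoint_of_exists_subalgebra_of_endAlgRat_comm {Z : siegelUpperHalfSpace g}
    (hex : ∃ T : Subalgebra ℚ (Matrix (Fin g ⊕ Fin g) (Fin g ⊕ Fin g) ℚ), T ≤ endAlgRat (prinPeriod Z) ∧ IsReduced T ∧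
      (∀ a ∈ T, ∀ b ∈ T, a * b = b * a) ∧ finrank ℚ T = Fintype.card (Fin g ⊕ Fin g))
    (hcomm : ∀ a ∈ endAlgRat (prinPeriod Z), ∀ b ∈ endAlgRat (prinPeriod Z), a * b = b * a) : IsCMPoint Z := by
  obtain ⟨T, hT, hred, hTc, hdim⟩ := hex
  haveI := hred
  obtain ⟨t, _, K, _, _, ρ, hρ, hrange⟩ := exists_isCMAlgTorusRat_of_comm_isReduced (prinPeriod Z) T hT hTc hdim
  have hE : T = endAlgRat (prinPeriod Z) := by rw [← hrange]; exact hρ.range_eq_endAlgRat_iff_comm.2 hcomm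
  subst hE
  exact isCMPoint_of_endAlgRat_comm hcomm hdim

/-- ★★ **«A POINT IS SPECIAL IFF IT IS A CM POINT», for `X_Z` with commutative `End_ℚ(X_Z)`**: `Z` is a Shimura CM point
(for some CM-algebra) iff the Hodge group `Hg(X_Z)(ℂ)` is commutative — Prop. 7.2.6 (i) ⟺ (ii) (the tree's
`IsAbelianVariety.hodgeGroupC_comm_iff_exists_comm_isReduced_le_endAlgRat`) with §3.
[cite: Lange2023AbelianVarietiesComplex, §7.2.3 Prop. 7.2.6] [cite: Deligne1982HodgeCycles, I Example 3.7, p. 42; I Prop. 5.1, p. 53] [cite: Shimura1998, §24.10, pp. 161–162] -/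
theorem isCMPoint_iff_hodgeGroupC_comm_of_endAlgRat_comm {Z : siegelUpperHalfSpace g}
    (hcomm : ∀ a ∈ endAlgRat (prinPeriod Z), ∀ b ∈ endAlgRat (prinPeriod Z), a * b = b * a) :
    IsCMPoint Z ↔ ∀ M ∈ hodgeGroupC (prinPeriod Z), ∀ N ∈ hodgeGroupC (prinPeriod Z), M * N = N * M := by
  refine ⟨fun hZ M hM N hN ↦ hZ.hodgeGroupC_comm hM hN, fun hHg ↦ ?_⟩
  have hX : IsAbelianVariety (prinPeriod Z) := ⟨prinForm Z, isRiemannForm_prinForm Z⟩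
  exact isCMPoint_of_exists_subalgebra_of_endAlgRat_comm
    (hX.hodgeGroupC_comm_iff_exists_comm_isReduced_le_endAlgRat.1 hHg) hcomm

end SiegelCMAlgPoint

end Literature.NumberTheory.ComplexMultiplication
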